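import Summits.FinalStateConjecture.FinalStateConjecture.Theses.EIHFluxBalance

/-!
# Sketch (crux-ideate round 1, ideator 2, generation 2) — first lemmas of the crux idea
`equivalence-principle-tubes` for `EIHFluxBalance.ModulatedKerrHandoff` (item stmt-FinalStateConjecture-10167)

The idea runs the `N = 1` Kerr-stability MACHINERY once per hole inside a tube of radius
`R(t) = D(t)^β` (`D` = separation), against ONE boosted Kerr–Schild form (the neighbours'
monopole + dipole being gauge, sibling lemma `LieDragSuperpositionDefect`), and budgets what crosses
a tube wall. The one new quantitative input is the DILUTION LEMMA below: the energy a free wave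
can push through a ball of radius `R` at distance `D` is at most `C (R/D)²` times its
rotation-commuted energies (two angular derivatives are lost — this is what forbids beaming).
Proof sketch (not formalised here): `H²(S²) ⊂ L^∞` on each sphere `S_r`, scaled:
`sup_{S_r} |∂φ|² ≤ C r⁻² Σ_{j ≤ 2} ∫_{S_r} |Ω^j ∂φ|² dσ`; the cap `S_r ∩ B(y, R)` has area
`≤ (π³/4) R²` (`SphereCapArea`); integrate `r` over `[D − R, D + R]` and use `D − R ≥ D/2`.

Statements only (`def … : Prop`), over Mathlib + the Lorentz prelude's `E3`; nothing is asserted.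
-/

noncomputable section

open scoped BigOperators
open MeasureTheory Metric Set Filter Topology
open Literature.Geometry.Lorentzian

namespace Summit.FinalStateConjecture.FinalStateConjecture.Cruxes.ModulatedKerrHandoff.EquivalencePrincipleTubes

/-- Flat partial derivative `∂_i f (x)` on `E3 = ℝ³`. -/
def pd (i : Fin 3) (f : E3 → ℝ) (x : E3) : ℝ := fderiv ℝ f x (EuclideanSpace.single i 1)

/-- Flat Laplacian `Δ f = Σ_i ∂_i ∂_i f`. -/
def lap (f : E3 → ℝ) (x : E3) : ℝ := ∑ i : Fin 3, pd i (pd i f) x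

/-- Time derivative of a field `φ : ℝ → E3 → ℝ`. -/
def dt (φ : ℝ → E3 → ℝ) (t : ℝ) (x : E3) : ℝ := deriv (fun s ↦ φ s x) t

/-- Rotation generator `Ω_{ij} f = x_i ∂_j f − x_j ∂_i f` (commutes with `□`). -/
def rot (i j : Fin 3) (f : E3 → ℝ) (x : E3) : ℝ := x i * pd j f x - x j * pd i f x

/-- Energy density `(∂_t φ)² + |∇φ|²` of the time-`t` slice. -/
def eDensity (φ : ℝ → E3 → ℝ) (t : ℝ) (x : E3) : ℝ := dt φ t x ^ 2 + ∑ i : Fin 3, pd i (φ t) x ^ 2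

/-- Energy of the time-`t` slice inside the set `S`. -/
def energyIn (φ : ℝ → E3 → ℝ) (t : ℝ) (S : Set E3) : ℝ := ∫ x in S, eDensity φ t x

/-- Rotation-commuted energy with up to two angular derivatives, `Σ_{j ≤ 2} E[Ω^j φ](t)`. -/
def angularEnergy₂ (φ : ℝ → E3 → ℝ) (t : ℝ) : ℝ :=
  energyIn φ t univ + ∑ i : Fin 3, ∑ j : Fin 3, energyIn (fun s ↦ rot i j (φ s)) t univ +
    ∑ i : Fin 3, ∑ j : Fin 3, ∑ k : Fin 3, ∑ l : Fin 3,
      energyIn (fun s ↦ rot i j (rot k l (φ s))) t univ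

/-- `φ` is a classical (`C⁴`) solution of the free wave equation `∂_t² φ = Δ φ` on `ℝ × ℝ³`. -/
def IsFreeWave (φ : ℝ → E3 → ℝ) : Prop :=
  ContDiff ℝ 4 (fun p : ℝ × E3 ↦ φ p.1 p.2) ∧ ∀ t x, dt (dt φ) t x = lap (φ t) x

/-- **FIRST LEMMA — dilution by solid angle.** There is a universal `C` such that for every
classical free wave `φ`, every ball `B(y, R)` with `2R ≤ |y|` and every time `t`, the energy of
`φ` inside `B(y, R)` is at most `C (R/|y|)²` times the rotation-commuted energy
`Σ_{j ≤ 2} E[Ω^j φ](t)` (conserved, so equal to its initial value). The same three-line proof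
bounds the energy THROUGHPUT of `B(y, R)` over all time by `C (R/D)²` times the angular-commuted
radiated energy (Sobolev on `S²` applied to the energy per solid angle). In the tube architecture:
hole `i` of current luminosity `Lᵢ(t) ≲ εᵢ(t)²` feeds hole `j`'s tube of radius `R = D^β` at the
`r^p`-weighted rate `R^p · Lᵢ (R/D)²/4 = Lᵢ R^{p+2}/(4D²) ∝ εᵢ(t)² t^{β(p+2) − 2}` (`D = vt`):
integrable in time already for bounded luminosity iff `β (p + 2) < 1` (crude window), and for
every `β < 1` once the emitter's own decay `Lᵢ ≲ ε² t^{−p−1+δ}` is fed back (joint bootstrap). -/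
def DilutionBySolidAngle : Prop :=
  ∃ C : ℝ, 0 < C ∧ ∀ (φ : ℝ → E3 → ℝ) (y : E3) (R t : ℝ), IsFreeWave φ → 0 < R → 2 * R ≤ ‖y‖ →
    energyIn φ t (ball y R) ≤ C * (R / ‖y‖) ^ 2 * angularEnergy₂ φ t

/-- The geometric input of the dilution lemma: the part of the sphere `S_r(0)` inside a ball
`B(y, R)` is a cap of angular radius `α` with `r sin α ≤ R`, hence of area
`2πr²(1 − cos α) ≤ π r² α² ≤ (π³/4) R²`, uniformly in `r`. -/
def SphereCapArea : Prop :=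
  ∀ (y : E3) (r R : ℝ), 0 < r → 0 < R →
    (μH[2] : Measure E3) (sphere (0 : E3) r ∩ ball y R) ≤ ENNReal.ofReal (Real.pi ^ 3 / 4 * R ^ 2)

/-- Companion (how the right-hand side is paid for data supported in `B(0, ρ)`): since
`|Ω^j ψ(x)| ≤ C_j Σ_{1 ≤ i ≤ j} |x|^i |D^i ψ(x)|` and `Ω` commutes with `□`, the rotation-commuted
energies of a free wave with data supported in `B(0, ρ)` are bounded, at all times, by the
scale-weighted Sobolev energies `Σ_{m ≤ 2} ρ^{2m} ∫ |D^{m+1} φ(0, ·)|²` of the data. -/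
def RotationEnergyOfSupportedData : Prop :=
  ∃ C : ℝ, 0 < C ∧ ∀ (φ : ℝ → E3 → ℝ) (ρ : ℝ), IsFreeWave φ → 0 < ρ →
    (∀ x : E3, ρ ≤ ‖x‖ → φ 0 x = 0 ∧ dt φ 0 x = 0) →
    ∀ t : ℝ, angularEnergy₂ φ t ≤ C * ∑ m ∈ Finset.range 3,
      ρ ^ (2 * m) * ∫ x : E3, ‖iteratedFDeriv ℝ (m + 1) (fun p : ℝ × E3 ↦ φ p.1 p.2) ((0 : ℝ), x)‖ ^ 2

/-- **Falsifier (c) at the level of the flat radial identity — the INTERIOR (tube-side)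
receding-wall `r^p` inequality.** Fixed angular order `ℓ`, flat `1+1` reduction
`Ψ_{uv} = −ℓ(ℓ+1)Ψ/(v−u)²` (`r = (v−u)/2`, `t = (v+u)/2`), tube wall `r = R₀ + κt`, i.e.
`v = w(u) := (2R₀ + (1+κ)u)/(1−κ)`, inner boundary `r = r₀`, i.e. `v = u + 2r₀`. Integrating the
Dafermos–Rodnianski identity `∂_u(r^pΨ_v²) + ∂_v(¼ℓ(ℓ+1)r^{p−2}Ψ²) + (p/2)r^{p−1}Ψ_v² +
⅛ℓ(ℓ+1)(2−p)r^{p−3}Ψ² = 0` over the INTERIOR region `{u₀ ≤ u ≤ u₁, u + 2r₀ ≤ v ≤ w(u)}` puts the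
wall's zero-order term on the GOOD side and charges only the incoming weighted flux through the
wall, `∫ r_w^p Ψ_v² w′ du` (the budget `η` of the card), plus a zero-order price at the inner
boundary (in the real problem: the redshift/Morawetz region, not treated by `r^p`). This is the
dual of the sibling card's exterior inequality `RecedingRpMonotonicity` (kit j011736: signs
confirmed). Stated for `0 < p ≤ 2`, `0 < κ < 1`, `0 < r₀ ≤ R₀`. -/
def InteriorRecedingRpInequality : Prop :=
  ∀ (p κ R₀ r₀ : ℝ) (ℓ : ℕ) (Ψ : ℝ → ℝ → ℝ), 0 < p → p ≤ 2 → 0 < κ → κ < 1 → 0 < r₀ → r₀ ≤ R₀ →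
    ContDiff ℝ 2 (fun q : ℝ × ℝ ↦ Ψ q.1 q.2) →
    (∀ u v, u + 2 * r₀ ≤ v → v ≤ (2 * R₀ + (1 + κ) * u) / (1 - κ) →
      deriv (fun u' ↦ deriv (fun v' ↦ Ψ u' v') v) u = -(ℓ * (ℓ + 1) : ℝ) * Ψ u v / (v - u) ^ 2) →
    ∀ u₀ u₁, u₀ ≤ u₁ →
      let w : ℝ → ℝ := fun u ↦ (2 * R₀ + (1 + κ) * u) / (1 - κ)
      let Ψv : ℝ → ℝ → ℝ := fun u v ↦ deriv (fun v' ↦ Ψ u v') v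
      (∫ v in Set.Icc (u₁ + 2 * r₀) (w u₁), ((v - u₁) / 2) ^ p * Ψv u₁ v ^ 2) +
        (ℓ * (ℓ + 1) : ℝ) / 4 * ∫ u in Set.Icc u₀ u₁, ((w u - u) / 2) ^ (p - 2) * Ψ u (w u) ^ 2 +
        p / 2 * ∫ u in Set.Icc u₀ u₁, ∫ v in Set.Icc (u + 2 * r₀) (w u),
          ((v - u) / 2) ^ (p - 1) * Ψv u v ^ 2 ≤
      (∫ v in Set.Icc (u₀ + 2 * r₀) (w u₀), ((v - u₀) / 2) ^ p * Ψv u₀ v ^ 2) +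
        (1 + κ) / (1 - κ) * ∫ u in Set.Icc u₀ u₁, ((w u - u) / 2) ^ p * Ψv u (w u) ^ 2 +
        (ℓ * (ℓ + 1) : ℝ) / 4 * r₀ ^ (p - 2) * ∫ u in Set.Icc u₀ u₁, Ψ u (u + 2 * r₀) ^ 2

/-- **Exponent window of the tube architecture** (pure arithmetic, PROVED). Tube radius
`R = D^β`, per-tube `r^p` weight `0 < p < 2`. In the CRUDE regime (neighbour's luminosity merely
bounded) the cross-radiation budget is `β (p + 2) < 1`; it then implies the quasi-static tidal
budgets: `β (p + 5) < 6` (`r^p`-size `M² R^{p+5}/D⁶ → 0`) and `2 β < 1 < 12/7` (KS curvature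
sup-weight on the tidal field, `R^{7/2} M/D³ → 0` needs `β < 6/7`). The one budget NOT implied is
the KS curvature sup-weight on cross-radiation itself (`R^{7/2} ε/D → 0`, i.e. `7β < 2`), which is
why the crude window is `0 < β < min(1/(p+2), 2/7)` — non-empty for every `p < 2`. -/
theorem tubeWindow (p β : ℝ) (hp : 0 < p) (_hp2 : p < 2) (hβ : 0 < β) (hw : β * (p + 2) < 1) :
    β * (p + 5) < 6 ∧ 2 * β < 1 := by
  have hβp : 0 < β * p := mul_pos hβ hp
  constructor <;> nlinarith [hβp]

/-- The crude window is non-empty: `β := 1/8` works for every `0 < p < 2` (`(p+2)/8 < 1/2`,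
`7/8 < 2`). PROVED. -/
theorem tubeWindow_nonempty (p : ℝ) (_hp : 0 < p) (hp2 : p < 2) :
    ∃ β : ℝ, 0 < β ∧ β * (p + 2) < 1 ∧ 7 * β < 2 :=
  ⟨1 / 8, by norm_num, by nlinarith, by norm_num⟩

end Summit.FinalStateConjecture.FinalStateConjecture.Cruxes.ModulatedKerrHandoff.EquivalencePrincipleTubes

end
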